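import Mathlib.Analysis.Calculus.Deriv.MeanValue
import Mathlib.Analysis.Calculus.LocalExtr.Basic
import Mathlib.Analysis.SpecialFunctions.Integrals.Basic
import Mathlib.Analysis.SpecialFunctions.Sqrt
import Mathlib.Topology.Order.Monotone
import HarnessLib

/-!
# Sturm comparison from a wall for a weak subsolution: `m / sin²(ω·)` is nondecreasing

Topic `Literature/MathematicalPhysics/QuantumManyBody` (namespace
`Literature.MathematicalPhysics.QuantumManyBody.BoseGas`, sub-namespace `MarginalSturm`). Third
support file for the **marginal Sturm package** (crux `RigidMomentumBound` of
`AtomisticToContinuum/BoseEinsteinCondensation`, stub `stub_sturmPackage`): the comparison argument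
proper, run on a `C¹` function `m ≥ 0` on `[0, S]` with `m(0) = 0` (the wall), derivative `p`, and
the *local* monotonicity of the Wronskian `W = p sin(ω·)/(2√m) - √m (ω cos(ω·))` of `q = √m` with
`sin(ω·)` on every interval where `m > 0` (the output of `MarginalSturmWronskian` +
`MarginalSturmTestMonotone`), `π/ω ≤ S`.

* `MarginalSturm.wall_wronskian_nonneg` — `V := p sin(ω·) - 2 m ω cos(ω·) = 2√m·W ≥ 0` on
  `(0, π/ω)`: at a zero of `m` both terms vanish (interior minimum); at `c` with `m c > 0` and
  `W c < 0`, monotonicity forces `W ≤ W c < 0` down to the last zero `a` of `m` before `c`, so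
  `(√m)' < 0` just to the right of `a` (there `√m → 0` and `sin(ω·) > 0`), contradicting
  `√m > 0 = √m(a)`.
* `MarginalSturm.monotoneOn_div_sin_sq` — hence `m / sin²(ω·)` is nondecreasing on `(0, π/ω)`
  (its derivative is `sin(ω·)·V / sin⁴(ω·)`): the weak form of `q(s)/sin(ωs) ↑`, i.e. of Sturm's
  comparison `q ≥ q(σ) sin(ω·)/sin(ωσ)` beyond `σ`.
* `MarginalSturm.le_integral_mul_sq_of_monotoneOn` — the quadratic wall bound
  `m(s) ≤ (4ω/π) (∫₀^{π/ω} m) (ωs)²` for `0 < s ≤ π/(2ω)` (compare on the second quarter period,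
  where `∫ sin²(ω·) = π/(4ω)`, `MarginalSturm.integral_sin_sq_quarter`; then `sin x ≤ x`).

Classical Sturm comparison (1836) in the form needed for a subsolution known only through its
Wronskian; tagged folklore. Deliberately NOT here: matched comparison from interior points, sharp
constants.
-/

noncomputable section

namespace Literature.MathematicalPhysics.QuantumManyBody.BoseGas

open _root_.MeasureTheory _root_.Filter _root_.Set _root_.Real intervalIntegral
open scoped Topology

namespace MarginalSturm

/-- **Sturm comparison from the wall: the Wronskian with `sin(ω·)` is nonnegative.** Let `ω > 0`,
`π/ω ≤ S`, `p` continuous, `m' = p` everywhere, `m 0 = 0`, `m ≥ 0` on `[0, S]`, and assume the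
local Wronskian monotonicity: `W a ≤ W b` whenever `0 < a < b < π/ω` and `m > 0` on `[a, b]`, where
`W = p sin(ω·)/(2√m) - √m (sin(ω·))'`. Then `V(c) = p(c) sin(ωc) - 2 m(c) ω cos(ωc) ≥ 0`
(`= 2√m · W`) for every `c ∈ (0, π/ω)`. Proof: if `m c = 0` then `p c = 0` (interior minimum);
otherwise let `a` be the last zero of `m` before `c`; if `W c < 0` then `W ≤ W c < 0` on `(a, c]`,
so `(√m)' = p/(2√m) < 0` near `a⁺` (`√m → 0` there while `sin(ω·) > 0`), contradicting
`√m > 0 = √m(a)` on `(a, c]`. [folklore] -/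
theorem wall_wronskian_nonneg {ω S : ℝ} {m p : ℝ → ℝ} (hω : 0 < ω) (hS : π / ω ≤ S)
    (hm : ∀ x, HasDerivAt m (p x) x) (hm0 : m 0 = 0)
    (hmnn : ∀ x ∈ Icc 0 S, 0 ≤ m x)
    (hmono : ∀ a b : ℝ, 0 < a → a < b → b < π / ω → (∀ x ∈ Icc a b, 0 < m x) →
      p a * sin (ω * a) / (2 * sqrt (m a)) - sqrt (m a) * (ω * cos (ω * a)) ≤
        p b * sin (ω * b) / (2 * sqrt (m b)) - sqrt (m b) * (ω * cos (ω * b)))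
    {c : ℝ} (hc : c ∈ Ioo 0 (π / ω)) :
    0 ≤ p c * sin (ω * c) - 2 * m c * (ω * cos (ω * c)) := by
  have hmc : Continuous m := continuous_iff_continuousAt.2 fun x => (hm x).continuousAt
  have hcS : c < S := hc.2.trans_le hS
  rcases (hmnn c ⟨hc.1.le, hcS.le⟩).eq_or_lt with h0 | hpos
  · -- `m c = 0`: an interior minimum, so `p c = 0`
    have hmin : IsLocalMin m c := by
      filter_upwards [Ioo_mem_nhds hc.1 hcS] with x hx
      rw [← h0]
      exact hmnn x ⟨hx.1.le, hx.2.le⟩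
    rw [hmin.hasDerivAt_eq_zero (hm c), ← h0]
    simp
  by_contra hV
  rw [not_le] at hV
  have hqc : 0 < sqrt (m c) := sqrt_pos.2 hpos
  -- `W c < 0`
  set κ : ℝ := -(p c * sin (ω * c) / (2 * sqrt (m c)) - sqrt (m c) * (ω * cos (ω * c))) with hκ
  have hκpos : 0 < κ := by
    have h1 : p c * sin (ω * c) / (2 * sqrt (m c)) - sqrt (m c) * (ω * cos (ω * c)) =
        (p c * sin (ω * c) - 2 * m c * (ω * cos (ω * c))) / (2 * sqrt (m c)) := by
      have hmx : m c = sqrt (m c) ^ 2 := (sq_sqrt hpos.le).symm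
      have hr0 : sqrt (m c) ≠ 0 := hqc.ne'
      generalize sqrt (m c) = r at hmx hr0 ⊢
      rw [hmx]
      field_simp
    rw [hκ, h1]
    have : (p c * sin (ω * c) - 2 * m c * (ω * cos (ω * c))) / (2 * sqrt (m c)) < 0 :=
      div_neg_of_neg_of_pos hV (by positivity)
    linarith
  -- the last zero `a` of `m` on `[0, c]`
  set Z : Set ℝ := Icc 0 c ∩ m ⁻¹' {0} with hZ
  have hZne : Z.Nonempty := ⟨0, ⟨le_rfl, hc.1.le⟩, hm0⟩
  have hZbdd : BddAbove Z := ⟨c, fun t ht => ht.1.2⟩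
  have hZcl : IsClosed Z := isClosed_Icc.inter (isClosed_singleton.preimage hmc)
  set a : ℝ := sSup Z with ha
  have haZ : a ∈ Z := hZcl.csSup_mem hZne hZbdd
  have ha0 : 0 ≤ a := haZ.1.1
  have hma : m a = 0 := haZ.2
  have hac : a < c := lt_of_le_of_ne haZ.1.2 fun h => hpos.ne' (by rw [← h]; exact hma)
  have hpos' : ∀ t ∈ Ioc a c, 0 < m t := fun t ht =>
    (hmnn t ⟨ha0.trans ht.1.le, ht.2.trans hcS.le⟩).lt_of_ne' fun h =>
      not_lt.2 (le_csSup hZbdd ⟨⟨ha0.trans ht.1.le, ht.2⟩, h⟩) ht.1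
  -- `W ≤ -κ` on `(a, c)`
  have hWle : ∀ t ∈ Ioo a c,
      p t * sin (ω * t) / (2 * sqrt (m t)) - sqrt (m t) * (ω * cos (ω * t)) ≤ -κ := fun t ht => by
    have := hmono t c (ha0.trans_lt ht.1) ht.2 hc.2 fun x hx => hpos' x ⟨ht.1.trans_le hx.1, hx.2⟩
    rw [hκ, neg_neg]
    exact this
  -- `√m` is small near `a`
  have hqcont : Continuous fun t => sqrt (m t) := hmc.sqrt
  have hqa : sqrt (m a) = 0 := by rw [hma, sqrt_zero]
  obtain ⟨δ, hδ, hδκ⟩ : ∃ δ > 0, ∀ t, |t - a| < δ → sqrt (m t) * ω < κ / 2 := by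
    obtain ⟨δ, hδ, h⟩ := Metric.continuousAt_iff.1 (hqcont.continuousAt (x := a)) (κ / (2 * ω))
      (by positivity)
    refine ⟨δ, hδ, fun t ht => ?_⟩
    have h' := h (show dist t a < δ by rwa [Real.dist_eq])
    rw [hqa, Real.dist_eq, sub_zero, abs_of_nonneg (sqrt_nonneg _)] at h'
    calc sqrt (m t) * ω < κ / (2 * ω) * ω := mul_lt_mul_of_pos_right h' hω
      _ = κ / 2 := by field_simp
  set δ' : ℝ := min δ (c - a) / 2 with hδ'
  have hδ'pos : 0 < δ' := by rw [hδ']; exact half_pos (lt_min hδ (sub_pos.2 hac))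
  have hδ'δ : δ' < δ := by
    rw [hδ']; linarith [min_le_left δ (c - a), lt_min hδ (sub_pos.2 hac)]
  have haδc : a + δ' < c := by
    rw [hδ']; linarith [min_le_right δ (c - a), lt_min hδ (sub_pos.2 hac)]
  -- `(√m)' < 0` on `(a, a + δ')`
  have hderiv_neg : ∀ t ∈ Ioo a (a + δ'), deriv (fun t => sqrt (m t)) t < 0 := fun t ht => by
    have htc : t ∈ Ioo a c := ⟨ht.1, ht.2.trans haδc⟩
    have hmt : 0 < m t := hpos' t ⟨htc.1, htc.2.le⟩
    have hd : HasDerivAt (fun t => sqrt (m t)) (p t / (2 * sqrt (m t))) t := (hm t).sqrt hmt.ne'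
    rw [hd.deriv]
    have hW := hWle t htc
    have hsmall : sqrt (m t) * ω < κ / 2 :=
      hδκ t (by rw [abs_of_pos (sub_pos.2 ht.1)]; linarith [ht.2])
    have hφpos : 0 < sin (ω * t) :=
      sin_pos_of_pos_of_lt_pi (mul_pos hω (ha0.trans_lt ht.1))
        (by rw [← lt_div_iff₀' hω]; exact htc.2.trans hc.2)
    have hcos : sqrt (m t) * (ω * cos (ω * t)) ≤ sqrt (m t) * ω := by
      have h1 := cos_le_one (ω * t)
      have h2 : 0 ≤ sqrt (m t) * ω := mul_nonneg (sqrt_nonneg _) hω.le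
      nlinarith
    have h1 : p t / (2 * sqrt (m t)) * sin (ω * t) < 0 := by
      have : p t * sin (ω * t) / (2 * sqrt (m t)) = p t / (2 * sqrt (m t)) * sin (ω * t) := by
        ring
      linarith
    exact neg_of_mul_neg_left h1 hφpos.le
  -- hence `√m` decreases strictly on `[a, a + δ']` from the value `0`: contradiction
  have hanti : StrictAntiOn (fun t => sqrt (m t)) (Icc a (a + δ')) :=
    strictAntiOn_of_deriv_neg (convex_Icc _ _) hqcont.continuousOn
      (by rw [interior_Icc]; exact hderiv_neg)
  have hlt := hanti (left_mem_Icc.2 (by linarith)) ⟨by linarith, by linarith⟩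
    (show a < a + δ' / 2 by linarith)
  simp only [hqa] at hlt
  exact absurd hlt (not_lt.2 (sqrt_nonneg _))

/-- **`m / sin²(ω·)` is nondecreasing on `(0, π/ω)`** when `m' = p` and the Wronskian quantity
`p sin(ω·) - 2 m ω cos(ω·)` is nonnegative there (its derivative is
`sin(ω·) (p sin(ω·) - 2mω cos(ω·)) / sin⁴(ω·) ≥ 0`). [folklore] -/
theorem monotoneOn_div_sin_sq {ω : ℝ} {m p : ℝ → ℝ} (hω : 0 < ω) (hm : ∀ x, HasDerivAt m (p x) x)
    (hV : ∀ c ∈ Ioo 0 (π / ω), 0 ≤ p c * sin (ω * c) - 2 * m c * (ω * cos (ω * c))) :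
    MonotoneOn (fun x => m x / sin (ω * x) ^ 2) (Ioo 0 (π / ω)) := by
  have hsinpos : ∀ x ∈ Ioo 0 (π / ω), 0 < sin (ω * x) := fun x hx =>
    sin_pos_of_pos_of_lt_pi (mul_pos hω hx.1) (by rw [← lt_div_iff₀' hω]; exact hx.2)
  have hdφ : ∀ x, HasDerivAt (fun x => sin (ω * x)) (ω * cos (ω * x)) x := fun x => by
    simpa [mul_comm] using ((hasDerivAt_id x).const_mul ω).sin
  have hd : ∀ x ∈ Ioo 0 (π / ω), HasDerivAt (fun x => m x / sin (ω * x) ^ 2)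
      ((p x * sin (ω * x) ^ 2 - m x * (2 * sin (ω * x) * (ω * cos (ω * x)))) /
        (sin (ω * x) ^ 2) ^ 2) x := fun x hx => by
    have h1 : HasDerivAt (fun x => sin (ω * x) ^ 2) (2 * sin (ω * x) * (ω * cos (ω * x))) x := by
      have := (hdφ x).mul (hdφ x)
      refine (this.congr_deriv (by ring)).congr_of_eventuallyEq
        (Eventually.of_forall fun y => ?_)
      simp [sq]
    exact (hm x).div h1 (pow_ne_zero 2 (hsinpos x hx).ne')
  refine monotoneOn_of_deriv_nonneg (convex_Ioo 0 (π / ω))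
    (fun x hx => (hd x hx).continuousAt.continuousWithinAt) ?_ ?_
  · rw [interior_Ioo]
    exact fun x hx => (hd x hx).differentiableAt.differentiableWithinAt
  · rw [interior_Ioo]
    intro x hx
    rw [(hd x hx).deriv]
    refine div_nonneg ?_ (by positivity)
    have : p x * sin (ω * x) ^ 2 - m x * (2 * sin (ω * x) * (ω * cos (ω * x))) =
        sin (ω * x) * (p x * sin (ω * x) - 2 * m x * (ω * cos (ω * x))) := by ring
    rw [this]
    exact mul_nonneg (hsinpos x hx).le (hV x hx)

/-- `∫_{π/(2ω)}^{π/ω} sin²(ωx) dx = π/(4ω)`. [folklore] -/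
theorem integral_sin_sq_quarter {ω : ℝ} (hω : 0 < ω) :
    ∫ x in (π / (2 * ω))..(π / ω), sin (ω * x) ^ 2 = π / (4 * ω) := by
  have h := intervalIntegral.integral_comp_mul_left (fun x => sin x ^ 2) hω.ne'
    (a := π / (2 * ω)) (b := π / ω)
  rw [h, show ω * (π / (2 * ω)) = π / 2 by field_simp, show ω * (π / ω) = π by field_simp,
    integral_sin_sq, sin_pi, cos_pi_div_two, smul_eq_mul]
  field_simp
  ring

/-- **Quadratic bound near the wall.** If `m ≥ 0` is continuous on `[0, π/ω]` and `m / sin²(ω·)`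
is nondecreasing on `(0, π/ω)`, then for `0 < s ≤ π/(2ω)`:
`m(s) ≤ (4ω/π) (∫₀^{π/ω} m) (ωs)²` — compare `m` on the second quarter period `[π/(2ω), π/ω]`
with `m(s) sin²(ω·)/sin²(ωs)`, integrate (`∫ sin² = π/(4ω)` there), and use `sin(ωs) ≤ ωs`.
[folklore] -/
theorem le_integral_mul_sq_of_monotoneOn {ω : ℝ} {m : ℝ → ℝ} (hω : 0 < ω) (hmc : Continuous m)
    (hmnn : ∀ x ∈ Icc 0 (π / ω), 0 ≤ m x)
    (hR : MonotoneOn (fun x => m x / sin (ω * x) ^ 2) (Ioo 0 (π / ω)))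
    {s : ℝ} (hs : s ∈ Ioc 0 (π / (2 * ω))) :
    m s ≤ 4 * ω / π * (∫ x in (0 : ℝ)..(π / ω), m x) * (ω * s) ^ 2 := by
  have hsinpos : ∀ x ∈ Ioo 0 (π / ω), 0 < sin (ω * x) := fun x hx =>
    sin_pos_of_pos_of_lt_pi (mul_pos hω hx.1) (by rw [← lt_div_iff₀' hω]; exact hx.2)
  have hL2 : 0 < π / (2 * ω) := by positivity
  have hL : π / (2 * ω) < π / ω := by
    rw [div_lt_div_iff_of_pos_left pi_pos (by positivity) hω]; linarith
  have hs' : s ∈ Ioo 0 (π / ω) := ⟨hs.1, hs.2.trans_lt hL⟩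
  have hsin_s : 0 < sin (ω * s) := hsinpos s hs'
  set R : ℝ := m s / sin (ω * s) ^ 2 with hRdef
  have hRnn : 0 ≤ R := div_nonneg (hmnn s ⟨hs.1.le, hs'.2.le⟩) (sq_nonneg _)
  have hI : ∫ x in (0 : ℝ)..(π / ω), m x =
      (∫ x in (0 : ℝ)..(π / (2 * ω)), m x) + ∫ x in (π / (2 * ω))..(π / ω), m x :=
    (integral_add_adjacent_intervals (hmc.intervalIntegrable _ _)
      (hmc.intervalIntegrable _ _)).symm
  have hI1 : 0 ≤ ∫ x in (0 : ℝ)..(π / (2 * ω)), m x :=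
    integral_nonneg hL2.le fun x hx => hmnn x ⟨hx.1, hx.2.trans hL.le⟩
  have hI2 : R * (π / (4 * ω)) ≤ ∫ x in (π / (2 * ω))..(π / ω), m x := by
    rw [← integral_sin_sq_quarter hω, ← intervalIntegral.integral_const_mul]
    refine integral_mono_on hL.le ((continuous_const.mul (by fun_prop)).intervalIntegrable _ _)
      (hmc.intervalIntegrable _ _) fun x hx => ?_
    rcases hx.2.eq_or_lt with h | h
    · subst h
      rw [show ω * (π / ω) = π by field_simp, sin_pi]
      simpa using hmnn (π / ω) ⟨hL2.le.trans hx.1, hx.2⟩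
    · have hx' : x ∈ Ioo 0 (π / ω) := ⟨hL2.trans_le hx.1, h⟩
      have := hR hs' hx' (hs.2.trans hx.1)
      simp only at this
      rwa [← hRdef, le_div_iff₀ (pow_pos (hsinpos x hx') 2)] at this
  have hR_le : R ≤ 4 * ω / π * ∫ x in (0 : ℝ)..(π / ω), m x := by
    rw [hI]
    have h4 : 0 < 4 * ω / π := by positivity
    have : R = 4 * ω / π * (R * (π / (4 * ω))) := by field_simp
    rw [this]
    exact mul_le_mul_of_nonneg_left (by linarith) h4.le
  have hms : m s = R * sin (ω * s) ^ 2 := by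
    rw [hRdef, div_mul_cancel₀ _ (pow_ne_zero 2 hsin_s.ne')]
  have hsin_le : sin (ω * s) ^ 2 ≤ (ω * s) ^ 2 :=
    pow_le_pow_left₀ hsin_s.le (sin_le (mul_nonneg hω.le hs.1.le)) 2
  calc m s = R * sin (ω * s) ^ 2 := hms
    _ ≤ R * (ω * s) ^ 2 := mul_le_mul_of_nonneg_left hsin_le hRnn
    _ ≤ 4 * ω / π * (∫ x in (0 : ℝ)..(π / ω), m x) * (ω * s) ^ 2 :=
      mul_le_mul_of_nonneg_right hR_le (sq_nonneg _)

end MarginalSturm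

end Literature.MathematicalPhysics.QuantumManyBody.BoseGas
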